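import Summits.QuantumFields.YangMills.Theorems.BalabanUVNodesN12MinimiserFamilyAtRecordBjTowerThreshold
import Literature.MathematicalPhysics.QuantumFieldTheory.Balaban1983to89.B15ShellGauge193Local
import Literature.MathematicalPhysics.QuantumFieldTheory.Balaban1983to89.B15Prop1Carrier
import HarnessLib

/-!
# BalabanUVNodes ∕ N12 — THE (J0′) JUNCTION BY NAME, EDITION OF RECORD: the knit's displayed `hMin` ROW SHAPE (12Q ∕ 12X-W «DIRECT v11», p703802 ∕ p704012), UNDER ONE ANNOUNCED
# GAUGE-TOLERANCE THRESHOLD `δ₀` AND `∃ R > 0`, FROM (E) + (δ) + (T1@q₀) PER BASE FIELD — (δ) plain or for a RESIDUAL re-gauging of the minimiser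
# ([Balaban1989LargeFieldI] (1.74) p.192, p.193 ll.14–20, Prop. 1 p.194; [Balaban1985Variational] Thm 1 p.279, (3)–(4),(7) p.278, Sect. C (44)–(48) p.285, (81)–(83) p.290, Sect. G
# pp.305–307, (181) p.307; [Balaban1989LargeFieldII] p.357, (1.7)–(1.9) p.358, (1.12)–(1.13) p.359; [Balaban1988Convergent] (2.2) p.255, (2.10)–(2.13) pp.256–257; [Balaban1985Averaging]
# (122)–(126) p.36; [Balaban1987RG1] (0.4) p.253)

Cell `pub-ymgap` (HUMAN RULINGS D-0062 ∕ D-0149), seat `pub-ymgap-dag-n12-d` g24 (R134 N12 [B15] s2 = by-name knit at the record; census item E1 = the (J0′) row; count-neutral helper of K1⁹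
`stmt-QuantumFields-27364`, `--kind proof --supports … --as helper`).  THEOREMS ONLY (0 `def`, 0 `instance`, 0 `sorry`); two compositions BY NAME.  Third leaf of the junction family
`N12MinimiserFamilyKnitRow` (p707982: over the (0.4)-guarded producers) ∕ `N12MinimiserFamilyKnitRowTower` (p711030 + p721314: over the tower capstones (O)∕(O′), per base field
(E) + (β) + (T1@q₀) resp. (E) + (δ) + (P) + (M) + (T1@q₀)) — own leaf for the 400-line rule; same statement recipe, same consumer recipe.

WHAT.  THIS FILE junctions the knit pair's displayed (J0′) row (binders `R 𝓐₀` + the ∀-body `hMin`) to this seat's twin of record `N12MinimiserFamilyAtRecordBjTowerThreshold.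
hMin_closedGuard_atRecord_Bj_of_printLetters_ofClassThreshold(_residual)` — the w1 lineage's chart theorem at `𝐁_k(Z)` over the LANE's THRESHOLD producer `N12MinimiserFamilyOfClassThreshold`
(dag-n12-c g26, V4: every analytic letter inside, ONE announced `δ₀ > 0` per (instance, height)) — and DISCHARGES the datum-regularity row from the knit's OWN geometry rows exactly as the
siblings: a base field of the closed guard `|V_k(∂p′) − 1| ≤ eR` on `(Z ∩ Λᶜ)^{(k)}` has a p. 193 extension `Ṽ_k = ext V_k` that is `12d(n+2)²·2eR`-regular on `Z^{(k)}`
(`B15ShellGauge193Local.dist1_plaqHol_extend_shellGauge_le`, [IV] p. 193 ll. 14–16), hence `2(cE+1)eR`-regular for the knit's extension constant `cE ≥ 12d(n+2)²` (12Q v11's `hcE`).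
RESULT (E1, knit side, edition of record): the knit's `hMin P i` row is — after the per-height existence letters `ρ″`∕`hHB` with volume-free floors and ONE announced threshold `δ₀` — for
every gauge tolerance `0 ≤ δc ≤ δ₀`, under `∃ R > 0`, a theorem BY NAME of EXACTLY (E) + (δ)@`δc` + (T1@q₀) per base field of the closed guard (§1), resp. (E) + (σ residual, (δ)@`δc` for
`U₀^σ`) + (T1@q₀) (§2 — the shape dag-n12-w3's (σ)_N producer `N12GaugeLetterLocOfClass.exists_gaugeLetterLoc_atRecord_of_class` delivers per base field: the road of record).

WHY NOT INSIDE THE KNIT (LOCATED-E1-KNIT): displaying these rows INSTEAD of `R 𝓐₀ hMin` in 12Q∕12X-W would bind the implicit-function radius existentially before the threshold∕floor rows —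
vacuous by shape; the junction lives consumer-side: `obtain ⟨δ₀, hδ₀, h⟩ := exists_R_hMinRow_of_printLetters_ofClassThreshold_residual …`, pick `δc ≤ δ₀` for the (σ)_N producer, then
`obtain ⟨R, hR, hMin⟩ := h hδc0 hδcδ (per-base-field rows)` feeds the knit at `R P i := R`.

HONEST FRAMING ∕ LOCATED.  Two compositions by name + 8 lines of arithmetic each; (E)∕(δ)∕(T1@q₀) DISPLAYED ([15] Thm 1 existence — NODE 00 ∕ b11; a gauge letter — the direct road's
(N) producers, LOCATED-GEOM v3; [15] Thm 1 uniqueness — N07 ∕ b11) — NOT discharged here; `δ₀`, `R`, `ρ″`, `εH`, `B` = EXISTENCE constants per (instance, height) (census U4; print's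
volume-uniform (46)∕(83) and `k`-uniformity NOT claimed); displayed coupling `6(d−1)Lᵏ·2(cE+1)eR ≤ ρ″` (guard radius against the height's radius letter); nothing of Bałaban's estimates
asserted; N12 NOT discharged; K1⁹ NOT closed; counts unmoved; one finite 𝕋⁴ programme at fixed `ε = L^{-K}` — R4 closes only the conditional rung `BalabanLadder.UV`; no summit statement is
proved here and NOT the Yang–Mills mass gap (Clay); nothing continuum ∕ ℝ⁴ ∕ OS.
-/

noncomputable section

namespace Summit.QuantumFields.YangMills.BalabanUVNodes.N12MinimiserFamilyKnitRowThreshold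

open scoped BigOperators Matrix.Norms.L2Operator Topology
open Literature.MathematicalPhysics.QuantumFieldTheory.Balaban1983to89
open T4Continuum
open B15DeterminingSets GaugeField
open ExpMeanLog (expMeanLogSU deltaSU)
open T4AdjointCovarianceUnitary (lieSU)
open Node00
open B15SU2ChartHolomorphic (genE)
open B15Prop1AnalyticExtClause (cplxVec)
open B15Prop1ChartCalculusSU2 (E3)
open T4CubeChartGnomonic (SU2)
open B14.Eq213DetSet (Bj maxDomT Bj_of_gt)
open B14.Eq213MaximalDomains (side)
open B14.Eq22Determines (IsBlockUnion)
open B14.Eq216Concrete (feeds)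
open B5Eq118OneStroke (iterBlockOf)
open B15Eq112TorusCover (lift)
open T4AxialGaugeSmallField (boxPlaqs castSite)
open Summit.QuantumFields.YangMills.BalabanUVNodes.N12MinimiserFamilyAtRecordBjTowerThreshold (hMin_closedGuard_atRecord_Bj_of_printLetters_ofClassThreshold
  hMin_closedGuard_atRecord_Bj_of_printLetters_ofClassThreshold_residual)
open Literature.MathematicalPhysics.QuantumFieldTheory.BalabanImbrieJaffe1984to88.BIJ85Eq453GaugeField (qsstarGIter0)
open B15AveragingHolomorphic (iterMh)
open B15SU2ChartHolomorphic (expMulC logCoordC)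
open B15ShellGauge193 (shellGauge)
open B15Extension193 (extend)
open B16Sect1Backgrounds (toMS expMul)
open B15Prop1ChartSU2 (su2Chart)
open Metric (ball)
open B15Prop1Carrier (plaqsInside)
open B15Prop1ClosedGuardUniformRadius (plaqLeOn_of_plaqSmallOn)
open B15ShellGauge193Local (dist1_plaqHol_extend_shellGauge_le)

variable {F : T4Family} {k : ℕ}



/-! ## §1  The knit's (J0′) row from (E) + (δ)@`δc` + (T1@q₀) per base field of the closed guard, after the announced threshold `δ₀` -/

/-- ★★★ **THE KNIT's (J0′) ROW SHAPE, AFTER ONE ANNOUNCED `δ₀ > 0`, UNDER `∃ R > 0`, FROM (E) + (δ) + (T1@q₀) PER BASE FIELD** — over the twin of record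
`N12MinimiserFamilyAtRecordBjTowerThreshold.hMin_closedGuard_atRecord_Bj_of_printLetters_ofClassThreshold` (w1 g4's chart theorem at `𝐁_k(Z)` over the lane's V4 producer, every analytic
letter inside) at `G := plaqsInside (pts k (Z ∩ Λᶜ))`, with the datum's scale-`k` regularity row DISCHARGED at `δ := 2(cE+1)·eR` from the closed guard on `(Z ∩ Λᶜ)^{(k)}` and the p. 193
extension (`dist1_plaqHol_extend_shellGauge_le`) through the knit's own geometry rows (`hn`, `hN3`, `hlohi`, `hbox`, `hZ`, `hcE`, `3 ≤ d`).  Once per height: `hsbU` + `12(d−1)L·εreg ≤ ρ″`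
+ `6(d−1)Lᵏ·2(cE+1)eR ≤ ρ″`, `hHB` + `εreg ≤ εH` + `0 ≤ B`; announced `∃ δ₀ > 0`; then for every `0 ≤ δc ≤ δ₀`, per base field of the closed guard: (E) the (2.12) minimiser `U₀`, (δ) `U₀`
bondwise `δc`-flat on the plaquettes meeting a bond sourced in `Ω₁(Z)`, (T1@q₀) over the closure of the class.  Conclusion: 12Q ∕ 12X-W v11's `hMin P i` ∀-body on the strict guard.
[cite: Balaban1989LargeFieldI, (1.74) p.192, p.193 L14–20, Prop. 1 p.194; Balaban1985Variational, Thm 1 p.279, (7) p.278, Sect. C (44)–(48) p.285, (81)–(83) p.290, Sect. G pp.305–307, Prop. 9 (190) p.309; Balaban1989LargeFieldII, p.357, (1.7)–(1.9) p.358, (1.12)–(1.13) p.359; Balaban1988Convergent, (2.2) p.255, (2.10)–(2.13) pp.256–257; Balaban1985Averaging, (122)–(126) p.36; Balaban1987RG1, (0.4) p.253] -/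
theorem exists_R_hMinRow_of_printLetters_ofClassThreshold (ν : Node00.Stage7Numerics) (Kt : ℕ) (hd3 : 3 ≤ (F.P Kt).d) (Z Λ : Set (Site (F.P Kt) 0))
    (lo hi : Fin (F.P Kt).d → ℤ) (hkK : k + 1 ≤ (F.P Kt).m + (F.P Kt).K) (hk1 : 1 ≤ k)
    (hdiv : side (F.P Kt).L ν.M₁ k ∣ (F.P Kt).sitesPerDir 0) (hfloor : ((F.P Kt).d + 14) * (F.P Kt).L ≤ ν.M₁) (hZblk : IsBlockUnion k Z) (hε : 0 < ν.εreg)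
    (hα3 : (143 * (((((F.P Kt).d + 4 : ℕ) : ℝ)) ^ 2 / 4) ^ 2) * (2 * ((F.P Kt).L : ℝ) ^ 2 * ν.εreg) ≤ 1 / 3)
    (hα2 : 2 * (2 * ((F.P Kt).L : ℝ) ^ 2 * ν.εreg) ≤ 2 * deltaSU (Fin 2) / ((((F.P Kt).d + 4) * (F.P Kt).L : ℕ) : ℝ) ^ 2)
    -- the per-HEIGHT letters (all EXISTENCE constants per (instance, height), inhabited by dag-n12-w6's `N12HsurjOfClass.exists_hsurjLetters`): the radius letter `hsbU` at `ρ″` with the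
    -- volume-free floor `12(d−1)L·εreg ≤ ρ″`; the right-inverse letter `hHB` at `(εH, B)`, `εreg ≤ εH`, `0 ≤ B`
    {ρ'' : ℝ} (hsbU : ∀ W : GaugeField (F.P Kt) 0 SU2, ‖coeField W - 1‖ ≤ ρ'' → SmallBelow (Node00.avOfRecord F 2 Kt) k W)
    (hερ : 12 * ((((F.P Kt).d - 1 : ℕ)) : ℝ) * (F.P Kt).L * ν.εreg ≤ ρ'')
    {εH B : ℝ}
    (hHB : ∀ (Wd : MSField (F.P Kt) SU2) (U₀ : GaugeField (F.P Kt) 0 SU2),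
      AgreeOn (Bj ν.M₁ Z k) (avgFamily (avOfRecord F 2 Kt) U₀) Wd →
      (∀ i' : Fin (constrCard (Bj ν.M₁ Z k) k), ∃ U' : GaugeField (F.P Kt) 0 SU2,
        (∀ b ∈ feeds (((constrEnum (Bj ν.M₁ Z k) k).symm i').1 : ℕ) ((constrEnum (Bj ν.M₁ Z k) k).symm i').2.1, U' b = U₀ b) ∧
          SmallBelow (avOfRecord F 2 Kt) k U') →
      (∀ (j : ℕ), 1 ≤ j → j ≤ k → ∀ y : Site (F.P Kt) j, embIter j y ∈ maxDomT ν.M₁ Z j → ∃ U' : GaugeField (F.P Kt) 0 SU2,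
        (∀ c : PBond (F.P Kt) j, (c.src = y ∨ c.tgt = y) → ∀ b₀ : PBond (F.P Kt) 0,
          (iterBlockOf j b₀.src = c.src ∨ iterBlockOf j b₀.src = c.tgt) → (iterBlockOf j b₀.tgt = c.src ∨ iterBlockOf j b₀.tgt = c.tgt) → U' b₀ = U₀ b₀) ∧
        SmallBelow (avOfRecord F 2 Kt) k U') →
      (∀ (j : ℕ), 1 ≤ j → j ≤ k → ∀ y : Site (F.P Kt) j, embIter j y ∈ maxDomT ν.M₁ Z j →
        PlaqSmallOn (boxPlaqs (fun κ => lift (F.P Kt) (embIter j y) κ - ((((F.P Kt).L ^ j : ℕ) : ℤ) + ((((F.P Kt).L ^ j - 1) / 2 : ℕ) : ℤ)))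
          (fun κ => lift (F.P Kt) (embIter j y) κ + ((((F.P Kt).L ^ j : ℕ) : ℤ) + ((((F.P Kt).L ^ j - 1) / 2 : ℕ) : ℤ))) : Set (Plaq (F.P Kt) 0)) εH U₀) →
      ∃ H : (Fin (constrCard (Bj ν.M₁ Z k) k) → lieSU (Fin 2)) → PBond (F.P Kt) 0 → lieSU (Fin 2),
        (∀ v, fderiv ℝ (msChart F 2 Kt k (Bj ν.M₁ Z k) Wd U₀) 0 (H v) = v) ∧ ∀ v, Real.sqrt (∑ b, ‖H v b‖ ^ 2) ≤ B * ‖v‖)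
    (hεH : ν.εreg ≤ εH) (hB0 : 0 ≤ B)
    (ext : GaugeField (F.P Kt) k SU2 → GaugeField (F.P Kt) k SU2) (hext : ∀ W, ext W = extend (pts k Λ) (shellGauge W lo hi) W)
    {𝓐₀ : ℝ} (h𝓐₀ : 1 < 𝓐₀) (eR : ℝ) (heR : 0 < eR)
    -- the knit's own GEOMETRY rows of the instance and the extension constant `cE ≥ 12d(n+2)²` (12Q v11's `hcE`), from which the datum's scale-`k` regularity on `Z` at
    -- `δ := 2(cE+1)·eR` follows (`dist1_plaqHol_extend_shellGauge_le`); the tower-box budget at that `δ` against the height's `ρ″`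
    (n : ℕ) (hn : ∀ κ, hi κ ≤ lo κ + n) (hN3 : ∀ κ, hi κ - lo κ + 3 < ((F.P Kt).sitesPerDir k : ℤ)) (hlohi : lo ≤ hi)
    (hbox : pts k Λ = (castSite '' Set.Icc lo hi : Set (Site (F.P Kt) k)))
    (hZ : (boxPlaqs (lo - 1) (hi + 1) : Set (Plaq (F.P Kt) k)) ⊆ plaqsInside (pts k Z))
    {cE : ℝ} (hcE : 12 * ((F.P Kt).d : ℝ) * ((n : ℝ) + 2) ^ 2 ≤ cE) (hδρ : 6 * ((((F.P Kt).d - 1 : ℕ)) : ℝ) * (F.P Kt).L ^ k * (2 * ((cE + 1) * eR)) ≤ ρ'') :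
    -- THE GAUGE-TOLERANCE THRESHOLD `δ₀` of the twin of record (announced before the base fields)
    ∃ δ₀ : ℝ, 0 < δ₀ ∧
    ∀ {δc : ℝ}, 0 ≤ δc → δc ≤ δ₀ →
    (∀ Vk : GaugeField (F.P Kt) k SU2, (∀ p ∈ plaqsInside (pts k (Z ∩ Λᶜ)), dist1 (GaugeField.plaqHol Vk p) ≤ eR) → ∃ U₀ : GaugeField (F.P Kt) 0 SU2,
      IsMinimizer (Node00.avOfRecord F 2 Kt) (Node00.regMSCoPOfRecord F 2 ν Kt k (maxDomT ν.M₁ Z)) (Bj ν.M₁ Z k)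
        (avgFamily (Node00.avOfRecord F 2 Kt) (qsstarGIter0 k (ext Vk))) U₀ ∧
      -- (NO datum-regularity row: discharged below from the closed guard on `Z ∩ Λᶜ` and the p. 193 extension)
      -- (δ) DISPLAYED — THE ONE GAUGE letter (the direct road's (N)-package clause): `U₀` bondwise `δc`-flat on the plaquettes meeting a bond sourced in `Ω₁(Z)`; the tower-flatness row (δ_T) and the multiplier row (M) of p717767 FOLLOW (`B15Prop1TowerFlatOfNearFlat`; dag-n12-w6's `…N12MultiplierLetterOfClass` + the lane's `…N12SliceDatumCurvatureOfClass`)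
      (∀ q : Plaq (F.P Kt) 0, ((⟨q.src, q.μ⟩ : PBond (F.P Kt) 0) ∈ {b : PBond (F.P Kt) 0 | b.src ∈ maxDomT ν.M₁ Z 1} ∨
          (⟨q.src.shift q.μ, q.ν⟩ : PBond (F.P Kt) 0) ∈ {b : PBond (F.P Kt) 0 | b.src ∈ maxDomT ν.M₁ Z 1} ∨
          (⟨q.src.shift q.ν, q.μ⟩ : PBond (F.P Kt) 0) ∈ {b : PBond (F.P Kt) 0 | b.src ∈ maxDomT ν.M₁ Z 1} ∨
          (⟨q.src, q.ν⟩ : PBond (F.P Kt) 0) ∈ {b : PBond (F.P Kt) 0 | b.src ∈ maxDomT ν.M₁ Z 1}) →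
        ‖((U₀ ⟨q.src, q.μ⟩ : SU2) : Matrix (Fin 2) (Fin 2) ℂ) - 1‖ ≤ δc ∧ ‖((U₀ ⟨q.src.shift q.μ, q.ν⟩ : SU2) : Matrix (Fin 2) (Fin 2) ℂ) - 1‖ ≤ δc ∧
          ‖((U₀ ⟨q.src.shift q.ν, q.μ⟩ : SU2) : Matrix (Fin 2) (Fin 2) ℂ) - 1‖ ≤ δc ∧ ‖((U₀ ⟨q.src, q.ν⟩ : SU2) : Matrix (Fin 2) (Fin 2) ℂ) - 1‖ ≤ δc) ∧
      -- (T1@q₀) — the capstone's row verbatim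
      (∀ U ∈ closure (Node00.regMSCoPOfRecord F 2 ν Kt k (maxDomT ν.M₁ Z)),
        AgreeOn (Bj ν.M₁ Z k) (avgFamily (Node00.avOfRecord F 2 Kt) U) (avgFamily (Node00.avOfRecord F 2 Kt) (qsstarGIter0 k (ext Vk))) →
        wilsonAction4 U ≤ wilsonAction4 U₀ →
          ∃ u : GaugeTransf (F.P Kt) 0 SU2, (∀ j, j ≤ k → ∀ b ∈ bondsOf (Bj ν.M₁ Z k j), toMS u j b.src = toMS u j b.tgt ∧ ∀ g : SU2, toMS u j b.src * g = g * toMS u j b.src) ∧ gaugeAct u U = U₀)) →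
    ∃ R : ℝ, 0 < R ∧ ∀ Vk : GaugeField (F.P Kt) k SU2, PlaqSmallOn (plaqsInside (pts k (Z ∩ Λᶜ))) eR Vk →
      ∃ Ũ : VecField (F.P Kt) k (EuclideanSpace ℂ (Fin 3)) × VecField (F.P Kt) k (EuclideanSpace ℂ (Fin 3)) → PBond (F.P Kt) 0 → Matrix (Fin 2) (Fin 2) ℂ,
        (∀ b i j, DifferentiableOn ℂ (fun z => Ũ z b i j) (ball 0 R)) ∧
        (∀ z ∈ ball (0 : VecField (F.P Kt) k (EuclideanSpace ℂ (Fin 3)) × VecField (F.P Kt) k (EuclideanSpace ℂ (Fin 3))) R, ∀ b i j, ‖Ũ z b i j‖ ≤ 𝓐₀) ∧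
        ∀ p B' : VecField (F.P Kt) k E3, ‖p‖ < R → ‖B'‖ < R → ∃ U' : GaugeField (F.P Kt) 0 SU2,
          (∀ b, Ũ (cplxVec p, cplxVec B') b = ((U' b : SU2) : Matrix (Fin 2) (Fin 2) ℂ)) ∧
            IsMinimizer (Node00.avOfRecord F 2 Kt) (Node00.regMSCoPOfRecord F 2 ν Kt k (maxDomT ν.M₁ Z)) (Bj ν.M₁ Z k)
              (avgFamily (Node00.avOfRecord F 2 Kt) (qsstarGIter0 k (expMul su2Chart B' (ext (expMul su2Chart p Vk))))) U' := by
  have hcE0 : 0 ≤ cE := le_trans (by positivity) hcE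
  have hδ : 0 < 2 * ((cE + 1) * eR) := by positivity
  obtain ⟨δ₀, hδ₀, h⟩ := hMin_closedGuard_atRecord_Bj_of_printLetters_ofClassThreshold ν Kt hd3 Z (pts k Λ) lo hi hkK hk1 hdiv hfloor hZblk hε hα3 hα2
    hsbU hερ hδ hδρ hHB hεH hB0 ext hext (plaqsInside (pts k (Z ∩ Λᶜ))) eR h𝓐₀
  refine ⟨δ₀, hδ₀, fun hδc0 hδcδ hletters => ?_⟩
  obtain ⟨R, hR, h'⟩ := h hδc0 hδcδ fun Vk hVk => by
      obtain ⟨U₀, hmin, hrowNF, hT1⟩ := hletters Vk hVk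
      refine ⟨U₀, hmin, fun p hp => ?_, hrowNF, hT1⟩
      -- the closed guard `≤ eR` gives the strict guard `< 2eR`; the p. 193 extension is then `12d(n+2)²·2eR`-regular on `Z^{(k)}`
      have h2 : PlaqSmallOn (plaqsInside (pts k (Z ∩ Λᶜ))) (2 * eR) Vk := fun q hq => (hVk q hq).trans_lt (by linarith)
      have hreg := (dist1_plaqHol_extend_shellGauge_le (G := SU2) hd3 hlohi hn hN3 hbox hZ (by positivity) h2).1 p hp
      rw [hext]
      refine hreg.trans_lt ?_
      have h1 : 12 * ((F.P Kt).d : ℝ) * ((n : ℝ) + 2) ^ 2 * (2 * eR) ≤ cE * (2 * eR) := mul_le_mul_of_nonneg_right hcE (by positivity)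
      have h3 : cE * (2 * eR) + 2 * eR = 2 * ((cE + 1) * eR) := by ring
      linarith
  exact ⟨R, hR, fun Vk hVk => h' Vk (plaqLeOn_of_plaqSmallOn hVk)⟩


/-! ## §2  The same with (δ) asked of a RESIDUAL re-gauging `U₀^σ` — the road of record (dag-n12-w3's (σ)_N producer supplies `σ` and the (δ) row per base field) -/

/-- ★★★ **THE KNIT's (J0′) ROW SHAPE FROM (E) + (σ residual, (δ)@`δc` for `U₀^σ`) + (T1@q₀) PER BASE FIELD** — §1 over the residual-gauge twin
`N12MinimiserFamilyAtRecordBjTowerThreshold.hMin_closedGuard_atRecord_Bj_of_printLetters_ofClassThreshold_residual`: per base field of the closed guard on `(Z ∩ Λᶜ)^{(k)}` the consumer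
supplies the (2.12) minimiser `U₀`, a RESIDUAL gauge `σ` (scale-`j` images `1` at both ends of every constrained bond of `𝐁_k(Z)`), (δ)@`δc` for `U₀^σ`, (T1@q₀) for `U₀` — the output of
`N12GaugeLetterLocOfClass.exists_gaugeLetterLoc_atRecord_of_class` up to the choice `δc ≤ δ₀`; the datum row discharged as in §1.  Conclusion: 12Q ∕ 12X-W v11's `hMin P i` ∀-body on the
strict guard.
[cite: Balaban1989LargeFieldI, (1.74) p.192, p.193 L14–20, Prop. 1 p.194; Balaban1985Variational, Thm 1 p.279, (3)–(4) p.278, (181) p.307, Prop. 9 (190) p.309; Balaban1989LargeFieldII, p.357, (1.12)–(1.13) p.359; Balaban1988Convergent, (2.10)–(2.13) pp.256–257; Balaban1987RG1, (0.4) p.253] -/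
theorem exists_R_hMinRow_of_printLetters_ofClassThreshold_residual (ν : Node00.Stage7Numerics) (Kt : ℕ) (hd3 : 3 ≤ (F.P Kt).d) (Z Λ : Set (Site (F.P Kt) 0))
    (lo hi : Fin (F.P Kt).d → ℤ) (hkK : k + 1 ≤ (F.P Kt).m + (F.P Kt).K) (hk1 : 1 ≤ k)
    (hdiv : side (F.P Kt).L ν.M₁ k ∣ (F.P Kt).sitesPerDir 0) (hfloor : ((F.P Kt).d + 14) * (F.P Kt).L ≤ ν.M₁) (hZblk : IsBlockUnion k Z) (hε : 0 < ν.εreg)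
    (hα3 : (143 * (((((F.P Kt).d + 4 : ℕ) : ℝ)) ^ 2 / 4) ^ 2) * (2 * ((F.P Kt).L : ℝ) ^ 2 * ν.εreg) ≤ 1 / 3)
    (hα2 : 2 * (2 * ((F.P Kt).L : ℝ) ^ 2 * ν.εreg) ≤ 2 * deltaSU (Fin 2) / ((((F.P Kt).d + 4) * (F.P Kt).L : ℕ) : ℝ) ^ 2)
    -- the per-HEIGHT letters (all EXISTENCE constants per (instance, height), inhabited by dag-n12-w6's `N12HsurjOfClass.exists_hsurjLetters`): the radius letter `hsbU` at `ρ″` with the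
    -- volume-free floor `12(d−1)L·εreg ≤ ρ″`; the right-inverse letter `hHB` at `(εH, B)`, `εreg ≤ εH`, `0 ≤ B`
    {ρ'' : ℝ} (hsbU : ∀ W : GaugeField (F.P Kt) 0 SU2, ‖coeField W - 1‖ ≤ ρ'' → SmallBelow (Node00.avOfRecord F 2 Kt) k W)
    (hερ : 12 * ((((F.P Kt).d - 1 : ℕ)) : ℝ) * (F.P Kt).L * ν.εreg ≤ ρ'')
    {εH B : ℝ}
    (hHB : ∀ (Wd : MSField (F.P Kt) SU2) (U₀ : GaugeField (F.P Kt) 0 SU2),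
      AgreeOn (Bj ν.M₁ Z k) (avgFamily (avOfRecord F 2 Kt) U₀) Wd →
      (∀ i' : Fin (constrCard (Bj ν.M₁ Z k) k), ∃ U' : GaugeField (F.P Kt) 0 SU2,
        (∀ b ∈ feeds (((constrEnum (Bj ν.M₁ Z k) k).symm i').1 : ℕ) ((constrEnum (Bj ν.M₁ Z k) k).symm i').2.1, U' b = U₀ b) ∧
          SmallBelow (avOfRecord F 2 Kt) k U') →
      (∀ (j : ℕ), 1 ≤ j → j ≤ k → ∀ y : Site (F.P Kt) j, embIter j y ∈ maxDomT ν.M₁ Z j → ∃ U' : GaugeField (F.P Kt) 0 SU2,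
        (∀ c : PBond (F.P Kt) j, (c.src = y ∨ c.tgt = y) → ∀ b₀ : PBond (F.P Kt) 0,
          (iterBlockOf j b₀.src = c.src ∨ iterBlockOf j b₀.src = c.tgt) → (iterBlockOf j b₀.tgt = c.src ∨ iterBlockOf j b₀.tgt = c.tgt) → U' b₀ = U₀ b₀) ∧
        SmallBelow (avOfRecord F 2 Kt) k U') →
      (∀ (j : ℕ), 1 ≤ j → j ≤ k → ∀ y : Site (F.P Kt) j, embIter j y ∈ maxDomT ν.M₁ Z j →
        PlaqSmallOn (boxPlaqs (fun κ => lift (F.P Kt) (embIter j y) κ - ((((F.P Kt).L ^ j : ℕ) : ℤ) + ((((F.P Kt).L ^ j - 1) / 2 : ℕ) : ℤ)))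
          (fun κ => lift (F.P Kt) (embIter j y) κ + ((((F.P Kt).L ^ j : ℕ) : ℤ) + ((((F.P Kt).L ^ j - 1) / 2 : ℕ) : ℤ))) : Set (Plaq (F.P Kt) 0)) εH U₀) →
      ∃ H : (Fin (constrCard (Bj ν.M₁ Z k) k) → lieSU (Fin 2)) → PBond (F.P Kt) 0 → lieSU (Fin 2),
        (∀ v, fderiv ℝ (msChart F 2 Kt k (Bj ν.M₁ Z k) Wd U₀) 0 (H v) = v) ∧ ∀ v, Real.sqrt (∑ b, ‖H v b‖ ^ 2) ≤ B * ‖v‖)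
    (hεH : ν.εreg ≤ εH) (hB0 : 0 ≤ B)
    (ext : GaugeField (F.P Kt) k SU2 → GaugeField (F.P Kt) k SU2) (hext : ∀ W, ext W = extend (pts k Λ) (shellGauge W lo hi) W)
    {𝓐₀ : ℝ} (h𝓐₀ : 1 < 𝓐₀) (eR : ℝ) (heR : 0 < eR)
    -- the knit's own GEOMETRY rows of the instance and the extension constant `cE ≥ 12d(n+2)²` (12Q v11's `hcE`), from which the datum's scale-`k` regularity on `Z` at
    -- `δ := 2(cE+1)·eR` follows (`dist1_plaqHol_extend_shellGauge_le`); the tower-box budget at that `δ` against the height's `ρ″`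
    (n : ℕ) (hn : ∀ κ, hi κ ≤ lo κ + n) (hN3 : ∀ κ, hi κ - lo κ + 3 < ((F.P Kt).sitesPerDir k : ℤ)) (hlohi : lo ≤ hi)
    (hbox : pts k Λ = (castSite '' Set.Icc lo hi : Set (Site (F.P Kt) k)))
    (hZ : (boxPlaqs (lo - 1) (hi + 1) : Set (Plaq (F.P Kt) k)) ⊆ plaqsInside (pts k Z))
    {cE : ℝ} (hcE : 12 * ((F.P Kt).d : ℝ) * ((n : ℝ) + 2) ^ 2 ≤ cE) (hδρ : 6 * ((((F.P Kt).d - 1 : ℕ)) : ℝ) * (F.P Kt).L ^ k * (2 * ((cE + 1) * eR)) ≤ ρ'') :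
    -- THE GAUGE-TOLERANCE THRESHOLD `δ₀` of the twin of record (announced before the base fields)
    ∃ δ₀ : ℝ, 0 < δ₀ ∧
    ∀ {δc : ℝ}, 0 ≤ δc → δc ≤ δ₀ →
    (∀ Vk : GaugeField (F.P Kt) k SU2, (∀ p ∈ plaqsInside (pts k (Z ∩ Λᶜ)), dist1 (GaugeField.plaqHol Vk p) ≤ eR) → ∃ (U₀ : GaugeField (F.P Kt) 0 SU2) (σ : GaugeTransf (F.P Kt) 0 SU2),
      IsMinimizer (Node00.avOfRecord F 2 Kt) (Node00.regMSCoPOfRecord F 2 ν Kt k (maxDomT ν.M₁ Z)) (Bj ν.M₁ Z k)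
        (avgFamily (Node00.avOfRecord F 2 Kt) (qsstarGIter0 k (ext Vk))) U₀ ∧
      -- (NO datum-regularity row: discharged below from the closed guard on `Z ∩ Λᶜ` and the p. 193 extension)
      -- a RESIDUAL gauge `σ` (scale-`j` images `1` at both ends of every constrained bond — dag-n12-w3's (σ)_N producer's shape) …
      (∀ j, j ≤ k → ∀ b ∈ bondsOf (Bj ν.M₁ Z k j), toMS σ j b.src = 1 ∧ toMS σ j b.tgt = 1) ∧
      -- … in which (δ) holds: `U₀^σ` bondwise `δc`-flat on the plaquettes meeting a bond sourced in `Ω₁(Z)`; the tower-flatness row (δ_T) and the multiplier row (M) of p717767 FOLLOW (`B15Prop1TowerFlatOfNearFlat`; dag-n12-w6's `…N12MultiplierLetterOfClass` + the lane's `…N12SliceDatumCurvatureOfClass`)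
      (∀ q : Plaq (F.P Kt) 0, ((⟨q.src, q.μ⟩ : PBond (F.P Kt) 0) ∈ {b : PBond (F.P Kt) 0 | b.src ∈ maxDomT ν.M₁ Z 1} ∨
          (⟨q.src.shift q.μ, q.ν⟩ : PBond (F.P Kt) 0) ∈ {b : PBond (F.P Kt) 0 | b.src ∈ maxDomT ν.M₁ Z 1} ∨
          (⟨q.src.shift q.ν, q.μ⟩ : PBond (F.P Kt) 0) ∈ {b : PBond (F.P Kt) 0 | b.src ∈ maxDomT ν.M₁ Z 1} ∨
          (⟨q.src, q.ν⟩ : PBond (F.P Kt) 0) ∈ {b : PBond (F.P Kt) 0 | b.src ∈ maxDomT ν.M₁ Z 1}) →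
        ‖((gaugeAct σ U₀ ⟨q.src, q.μ⟩ : SU2) : Matrix (Fin 2) (Fin 2) ℂ) - 1‖ ≤ δc ∧ ‖((gaugeAct σ U₀ ⟨q.src.shift q.μ, q.ν⟩ : SU2) : Matrix (Fin 2) (Fin 2) ℂ) - 1‖ ≤ δc ∧
          ‖((gaugeAct σ U₀ ⟨q.src.shift q.ν, q.μ⟩ : SU2) : Matrix (Fin 2) (Fin 2) ℂ) - 1‖ ≤ δc ∧ ‖((gaugeAct σ U₀ ⟨q.src, q.ν⟩ : SU2) : Matrix (Fin 2) (Fin 2) ℂ) - 1‖ ≤ δc) ∧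
      -- (T1@q₀) — the capstone's row verbatim
      (∀ U ∈ closure (Node00.regMSCoPOfRecord F 2 ν Kt k (maxDomT ν.M₁ Z)),
        AgreeOn (Bj ν.M₁ Z k) (avgFamily (Node00.avOfRecord F 2 Kt) U) (avgFamily (Node00.avOfRecord F 2 Kt) (qsstarGIter0 k (ext Vk))) →
        wilsonAction4 U ≤ wilsonAction4 U₀ →
          ∃ u : GaugeTransf (F.P Kt) 0 SU2, (∀ j, j ≤ k → ∀ b ∈ bondsOf (Bj ν.M₁ Z k j), toMS u j b.src = toMS u j b.tgt ∧ ∀ g : SU2, toMS u j b.src * g = g * toMS u j b.src) ∧ gaugeAct u U = U₀)) →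
    ∃ R : ℝ, 0 < R ∧ ∀ Vk : GaugeField (F.P Kt) k SU2, PlaqSmallOn (plaqsInside (pts k (Z ∩ Λᶜ))) eR Vk →
      ∃ Ũ : VecField (F.P Kt) k (EuclideanSpace ℂ (Fin 3)) × VecField (F.P Kt) k (EuclideanSpace ℂ (Fin 3)) → PBond (F.P Kt) 0 → Matrix (Fin 2) (Fin 2) ℂ,
        (∀ b i j, DifferentiableOn ℂ (fun z => Ũ z b i j) (ball 0 R)) ∧
        (∀ z ∈ ball (0 : VecField (F.P Kt) k (EuclideanSpace ℂ (Fin 3)) × VecField (F.P Kt) k (EuclideanSpace ℂ (Fin 3))) R, ∀ b i j, ‖Ũ z b i j‖ ≤ 𝓐₀) ∧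
        ∀ p B' : VecField (F.P Kt) k E3, ‖p‖ < R → ‖B'‖ < R → ∃ U' : GaugeField (F.P Kt) 0 SU2,
          (∀ b, Ũ (cplxVec p, cplxVec B') b = ((U' b : SU2) : Matrix (Fin 2) (Fin 2) ℂ)) ∧
            IsMinimizer (Node00.avOfRecord F 2 Kt) (Node00.regMSCoPOfRecord F 2 ν Kt k (maxDomT ν.M₁ Z)) (Bj ν.M₁ Z k)
              (avgFamily (Node00.avOfRecord F 2 Kt) (qsstarGIter0 k (expMul su2Chart B' (ext (expMul su2Chart p Vk))))) U' := by
  have hcE0 : 0 ≤ cE := le_trans (by positivity) hcE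
  have hδ : 0 < 2 * ((cE + 1) * eR) := by positivity
  obtain ⟨δ₀, hδ₀, h⟩ := hMin_closedGuard_atRecord_Bj_of_printLetters_ofClassThreshold_residual ν Kt hd3 Z (pts k Λ) lo hi hkK hk1 hdiv hfloor hZblk hε hα3 hα2
    hsbU hερ hδ hδρ hHB hεH hB0 ext hext (plaqsInside (pts k (Z ∩ Λᶜ))) eR h𝓐₀
  refine ⟨δ₀, hδ₀, fun hδc0 hδcδ hletters => ?_⟩
  obtain ⟨R, hR, h'⟩ := h hδc0 hδcδ fun Vk hVk => by
      obtain ⟨U₀, σ, hmin, hσ, hrowNF, hT1⟩ := hletters Vk hVk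
      refine ⟨U₀, σ, hmin, fun p hp => ?_, hσ, hrowNF, hT1⟩
      -- the closed guard `≤ eR` gives the strict guard `< 2eR`; the p. 193 extension is then `12d(n+2)²·2eR`-regular on `Z^{(k)}`
      have h2 : PlaqSmallOn (plaqsInside (pts k (Z ∩ Λᶜ))) (2 * eR) Vk := fun q hq => (hVk q hq).trans_lt (by linarith)
      have hreg := (dist1_plaqHol_extend_shellGauge_le (G := SU2) hd3 hlohi hn hN3 hbox hZ (by positivity) h2).1 p hp
      rw [hext]
      refine hreg.trans_lt ?_
      have h1 : 12 * ((F.P Kt).d : ℝ) * ((n : ℝ) + 2) ^ 2 * (2 * eR) ≤ cE * (2 * eR) := mul_le_mul_of_nonneg_right hcE (by positivity)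
      have h3 : cE * (2 * eR) + 2 * eR = 2 * ((cE + 1) * eR) := by ring
      linarith
  exact ⟨R, hR, fun Vk hVk => h' Vk (plaqLeOn_of_plaqSmallOn hVk)⟩

end Summit.QuantumFields.YangMills.BalabanUVNodes.N12MinimiserFamilyKnitRowThreshold

end
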